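import Literature.LinearAlgebra.Matrix.HermitianCfcDiagonalForm
import HarnessLib

/-!
# Functions of a real symmetric matrix commute with complexification

Topic `LinearAlgebra/Matrix`, namespace `Literature.LinearAlgebra.Matrix`.  For a real symmetric
matrix `A` and `f : ℝ → ℝ`, the complexification of `f(A)` is `f` of the complexification:
`(cfc f A) ⊗ ℂ = cfc f (A ⊗ ℂ)` (both are the value of one interpolating real polynomial, and
`p(A) ⊗ ℂ = p(A ⊗ ℂ)` for polynomials — Higham, *Functions of Matrices*, §1.2, Theorem 1.3 and
§1.3 (a primary matrix function of a real matrix with real data is real)).  Consequently the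
spectral sums `Σ_k f(λ_k)` of `A` and of `A ⊗ ℂ` agree (both are `tr f(·)`), which lets real
lattice operators be analysed through the complex characters that diagonalise their
complexifications.

## Contents (everything is proved; no definition and no named fact is introduced)

* `isHermitian_map_ofReal` — `A ⊗ ℂ` is Hermitian for `A` real symmetric;
* **`cfc_map_ofReal`** — `(cfc f A).map ofReal = cfc f (A.map ofReal)`;
* `trace_map_ofReal`, **`sum_eigenvalues_map_ofReal`** — `Σ_k f(λ_k(A ⊗ ℂ)) = Σ_k f(λ_k(A))`.

## References

* N. J. Higham, *Functions of Matrices* (SIAM 2008), §1.2 Thm. 1.3, §1.3. [Higham2008]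
-/

noncomputable section

open Matrix Polynomial
open scoped MatrixOrder ComplexOrder

namespace Literature.LinearAlgebra.Matrix

variable {n : Type*} [Fintype n] [DecidableEq n]

omit [Fintype n] [DecidableEq n] in
/-- The complexification of a real symmetric matrix is Hermitian. [folklore] -/
theorem isHermitian_map_ofReal {A : Matrix n n ℝ} (hA : A.IsHermitian) :
    (A.map (algebraMap ℝ ℂ)).IsHermitian := by
  ext i j
  have h := hA.apply i j
  rw [Matrix.conjTranspose_apply, Matrix.map_apply, Matrix.map_apply, ← h]
  simp

/-- The complexification as the value of the `ℝ`-algebra homomorphism `mapMatrix ofId`.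
[folklore] -/
theorem map_ofReal_eq_mapMatrix (A : Matrix n n ℝ) :
    A.map (algebraMap ℝ ℂ) = (Algebra.ofId ℝ ℂ).mapMatrix A := by
  rw [AlgHom.mapMatrix_apply]
  rfl

/-- **Functions of a real symmetric matrix commute with complexification**:
`(cfc f A).map ofReal = cfc f (A.map ofReal)`. [cite: Higham2008, §1.2 Thm. 1.3 and §1.3 (functions of real matrices via the interpolating polynomial)] -/
theorem cfc_map_ofReal {A : Matrix n n ℝ} (hA : A.IsHermitian) (f : ℝ → ℝ) :
    (cfc f A).map (algebraMap ℝ ℂ) = cfc f (A.map (algebraMap ℝ ℂ)) := by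
  have hAc := isHermitian_map_ofReal hA
  obtain ⟨p, hp⟩ := exists_polynomial_eval_eq
    (spectrum ℝ A ∪ spectrum ℝ (A.map (algebraMap ℝ ℂ)))
    (Matrix.finite_real_spectrum.union Matrix.finite_real_spectrum) f
  rw [cfc_eq_aeval_of_eval_eq hA f p (fun x hx => hp x (Set.mem_union_left _ hx)),
    cfc_eq_aeval_of_eval_eq hAc f p (fun x hx => hp x (Set.mem_union_right _ hx)),
    map_ofReal_eq_mapMatrix, map_ofReal_eq_mapMatrix, aeval_algHom_apply]

omit [DecidableEq n] in
/-- `tr (A ⊗ ℂ) = tr A`. [folklore] -/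
theorem trace_map_ofReal (A : Matrix n n ℝ) :
    trace (A.map (algebraMap ℝ ℂ)) = ((trace A : ℝ) : ℂ) := by
  simp [Matrix.trace, Matrix.map_apply]

/-- **Spectral sums are invariant under complexification**: `Σ_k f(λ_k(A ⊗ ℂ)) = Σ_k f(λ_k(A))`
for a real symmetric `A` (Mathlib's eigenvalue enumerations on each side).
[cite: Higham2008, §1.3 (real data give real primary matrix functions)] -/
theorem sum_eigenvalues_map_ofReal {A : Matrix n n ℝ} (hA : A.IsHermitian)
    (hAc : (A.map (algebraMap ℝ ℂ)).IsHermitian) (f : ℝ → ℝ) :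
    ∑ k, f (hAc.eigenvalues k) = ∑ k, f (hA.eigenvalues k) := by
  have h1 := trace_cfc_eq_sum_eigenvalues hAc f
  rw [← cfc_map_ofReal hA f, trace_map_ofReal, trace_cfc_eq_sum_eigenvalues hA f] at h1
  simp only [RCLike.ofReal_real_eq_id, id_eq] at h1
  exact (RCLike.ofReal_injective (K := ℂ) h1).symm

end Literature.LinearAlgebra.Matrix

end
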